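import Literature.AlgebraicGeometry.Frobenioids.Cor54RigidityArithObjects
import Literature.AlgebraicGeometry.Frobenioids.Cor54RigidityReduction
import Literature.AlgebraicGeometry.Frobenioids.Cor54RigidityLinearReduction
import Literature.AlgebraicGeometry.Frobenioids.Cor54SubStrongUniqueReduction
import HarnessLib

/-!
# Frobenioids I, Corollary 5.4 at `C_{K/F}`: rigidity of `C^un-tr → C^rlf` and the strong 1-uniqueness
# clause, reduced to LINEAR hom-rigidity (sub-DAG row C54-core-arith, file 5-red)

Mochizuki, *The geometry of Frobenioids I: the general theory*, Kyushu J. Math. **62** (2008) 293–400,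
Corollary 5.4 p. 104, at the arithmetic Frobenioids `C_{K/F}` of Example 6.3 / Theorem 6.4 pp. 113–116.
[cite: MochizukiFrdI2008, Cor. 5.4 p.104]

PROOF-ONLY file (seat abc-iut-w5-d048, L1-lead R111 (2)/R123/R124: sub-row (5); no definitions). For THE
arithmetic Frobenioid `C_{K/F}` (model descriptions `F_arith = ModelFrobenioid.toElem Φ B (B → Φ^gp)`, THE data)
this file assembles the pieces that do not depend on the data-level identity `ρ k = k`:

* `FrdI.Cor54Sub.untrToRlf_rigid_arith_of_linear` — **`hrig` at `C_{K/F}`** (every endofunctor `T` of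
  `C_{K/F}^rlf` with `untrToRlf ⋙ T ≅ untrToRlf` is `≅ 𝟭`) FROM linear hom-rigidity `hlin` (every functorial
  self-map `ρ` of the homs between `untrToRlf`-image objects fixing the `untrToRlf f` fixes every morphism of
  Frobenius degree `1` over `id_A`): essential surjectivity (`untrToRlf_essSurj_arith`, arithmetic: finiteness of
  the class number and Dirichlet) + the generic reductions `rigidAlong_of_essSurj_of_homRigid`
  (`Cor54RigidityReduction`) and `ModelFrobenioid.DataHom.homRigid_of_homRigid_linear` (abc-iut-L1-d8,
  `Cor54RigidityLinearReduction`);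
* `FrdI.Cor54Sub.strongUnique_arith_of_linear` — the **strong 1-uniqueness clause of Cor. 5.4 AS TYPED**
  (`Nonempty (Ψ' ≅ Ψ^rlf)` for every `Ψ'` filling THE square) at `C₁ = C_{K/F}`, from `hlin`, via
  `strongUnique_of_rigidAlong_untrToRlf` (`Cor54SubStrongUniqueReduction`).

`hlin` is EXACTLY the conclusion of the data-level file `Cor54RigidityArithMorphisms` (abc-iut-w5-d227 /
abc-iut-L1-d9, R124 (1)); once it lands, both theorems close unconditionally by one application each. The
binder is displayed, not hidden; nothing here bears on [IUTchIII] Cor. 3.12.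
-/

noncomputable section

namespace Literature.AlgebraicGeometry.Frobenioids

namespace FrdI.Cor54Sub

open CategoryTheory Opposite ModelFrobenioid

universe u₂' v₂' u₂ v₂

variable {F : Type} [Field F] [NumberField F] {K : Type} [Field K] [Algebra F K]
  (hΦ : PreFrobenioid.IsPerfFactorialOn (arithDivisorFunctor F K))

/-- **`hrig` at `C_{K/F}` from linear hom-rigidity.** [cite: MochizukiFrdI2008, Cor. 5.4 p.104] -/
theorem untrToRlf_rigid_arith_of_linear
    (hlin : ∀ (ρ : ∀ ⦃a a' : (PreFrobenioid.biratSubfunctor (ModelFrobenioid.toElem (arithDivisorFunctor F K) (unitsFunctor F K) (divNatTrans F K))).ModelOf⦄, ((PreFrobenioid.untrToRlf (ModelFrobenioid.toElem (arithDivisorFunctor F K) (unitsFunctor F K) (divNatTrans F K)) hΦ).obj a ⟶ (PreFrobenioid.untrToRlf (ModelFrobenioid.toElem (arithDivisorFunctor F K) (unitsFunctor F K) (divNatTrans F K)) hΦ).obj a') → ((PreFrobenioid.untrToRlf (ModelFrobenioid.toElem (arithDivisorFunctor F K) (unitsFunctor F K) (divNatTrans F K)) hΦ).obj a ⟶ (PreFrobenioid.untrToRlf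 (ModelFrobenioid.toElem (arithDivisorFunctor F K) (unitsFunctor F K) (divNatTrans F K)) hΦ).obj a')),
      (∀ ⦃a a' a'' : (PreFrobenioid.biratSubfunctor (ModelFrobenioid.toElem (arithDivisorFunctor F K) (unitsFunctor F K) (divNatTrans F K))).ModelOf⦄ (h : (PreFrobenioid.untrToRlf (ModelFrobenioid.toElem (arithDivisorFunctor F K) (unitsFunctor F K) (divNatTrans F K)) hΦ).obj a ⟶ (PreFrobenioid.untrToRlf (ModelFrobenioid.toElem (arithDivisorFunctor F K) (unitsFunctor F K) (divNatTrans F K)) hΦ).obj a') (k : (PreFrobenioid.untrToRlf (ModelFrobenioid.toElem (arithDivisorFunctor F K) (unitsFunctor F K) (divNatTrans F K)) hΦ).obj a' ⟶ (PreFrobenioid.untrToRlf (ModelFrobenioid.toElem (arithDivisorFunctor F K) (unitsFunctor F K) (divNatTrans F K)) hΦ).obj a''),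
        ρ (h ≫ k) = ρ h ≫ ρ k) →
      (∀ ⦃a a' : (PreFrobenioid.biratSubfunctor (ModelFrobenioid.toElem (arithDivisorFunctor F K) (unitsFunctor F K) (divNatTrans F K))).ModelOf⦄ (f : a ⟶ a'), ρ ((PreFrobenioid.untrToRlf (ModelFrobenioid.toElem (arithDivisorFunctor F K) (unitsFunctor F K) (divNatTrans F K)) hΦ).map f) = (PreFrobenioid.untrToRlf (ModelFrobenioid.toElem (arithDivisorFunctor F K) (unitsFunctor F K) (divNatTrans F K)) hΦ).map f) →
      ∀ (A : FinSubextCat F K) (γ γ' : Algebra.GrothendieckGroup ((arithDivisorFunctor F K).obj (op A)))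
        (k : (PreFrobenioid.untrToRlf (ModelFrobenioid.toElem (arithDivisorFunctor F K) (unitsFunctor F K) (divNatTrans F K)) hΦ).obj ⟨A, γ⟩ ⟶ (PreFrobenioid.untrToRlf (ModelFrobenioid.toElem (arithDivisorFunctor F K) (unitsFunctor F K) (divNatTrans F K)) hΦ).obj ⟨A, γ'⟩), degFr k = 1 → baseMap k = 𝟙 A → ρ k = k) :
    ∀ T : PreFrobenioid.rlf (ModelFrobenioid.toElem (arithDivisorFunctor F K) (unitsFunctor F K) (divNatTrans F K)) hΦ ⥤ PreFrobenioid.rlf (ModelFrobenioid.toElem (arithDivisorFunctor F K) (unitsFunctor F K) (divNatTrans F K)) hΦ,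
      Nonempty ((PreFrobenioid.untrToRlf (ModelFrobenioid.toElem (arithDivisorFunctor F K) (unitsFunctor F K) (divNatTrans F K)) hΦ) ⋙ T ≅ (PreFrobenioid.untrToRlf (ModelFrobenioid.toElem (arithDivisorFunctor F K) (unitsFunctor F K) (divNatTrans F K)) hΦ)) → Nonempty (T ≅ 𝟭 _) := by
  haveI := untrToRlf_essSurj_arith (F := F) (K := K) hΦ
  exact rigidAlong_of_essSurj_of_homRigid (PreFrobenioid.untrToRlf (ModelFrobenioid.toElem (arithDivisorFunctor F K) (unitsFunctor F K) (divNatTrans F K)) hΦ) (fun ρ hcomp hmap =>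
    ModelFrobenioid.DataHom.homRigid_of_homRigid_linear ((RealificationData.canonical (arithDivisorFunctor F K) (PreFrobenioid.IsPerfFactorialOn.op hΦ)).ofBaseData (PreFrobenioid.biratSubfunctor (ModelFrobenioid.toElem (arithDivisorFunctor F K) (unitsFunctor F K) (divNatTrans F K)))) ρ hcomp hmap
      (hlin ρ hcomp hmap))

/-- **The strong 1-uniqueness clause of Cor. 5.4 AS TYPED, at `C₁ = C_{K/F}`, from linear hom-rigidity**:
for THE square of Cor. 5.4 (`Square`: `Ψ^istr`, the comparison equivalences `e₁, e₂`, an equivalence `Ψ^rlf`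
filling it), EVERY `Ψ'` filling the square is `≅ Ψ^rlf`. [cite: MochizukiFrdI2008, Cor. 5.4 p.104] -/
theorem strongUnique_arith_of_linear
    (hlin : ∀ (ρ : ∀ ⦃a a' : (PreFrobenioid.biratSubfunctor (ModelFrobenioid.toElem (arithDivisorFunctor F K) (unitsFunctor F K) (divNatTrans F K))).ModelOf⦄, ((PreFrobenioid.untrToRlf (ModelFrobenioid.toElem (arithDivisorFunctor F K) (unitsFunctor F K) (divNatTrans F K)) hΦ).obj a ⟶ (PreFrobenioid.untrToRlf (ModelFrobenioid.toElem (arithDivisorFunctor F K) (unitsFunctor F K) (divNatTrans F K)) hΦ).obj a') → ((PreFrobenioid.untrToRlf (ModelFrobenioid.toElem (arithDivisorFunctor F K) (unitsFunctor F K) (divNatTrans F K)) hΦ).obj a ⟶ (PreFrobenioid.untrToRlf (ModelFrobenioid.toElem (arithDivisorFunctor F K) (unitsFunctor F K) (divNatTrans F K)) hΦ).obj a')),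
      (∀ ⦃a a' a'' : (PreFrobenioid.biratSubfunctor (ModelFrobenioid.toElem (arithDivisorFunctor F K) (unitsFunctor F K) (divNatTrans F K))).ModelOf⦄ (h : (PreFrobenioid.untrToRlf (ModelFrobenioid.toElem (arithDivisorFunctor F K) (unitsFunctor F K) (divNatTrans F K)) hΦ).obj a ⟶ (PreFrobenioid.untrToRlf (ModelFrobenioid.toElem (arithDivisorFunctor F K) (unitsFunctor F K) (divNatTrans F K)) hΦ).obj a') (k : (PreFrobenioid.untrToRlf (ModelFrobenioid.toElem (arithDivisorFunctor F K) (unitsFunctor F K) (divNatTrans F K)) hΦ).obj a' ⟶ (PreFrobenioid.untrToRlf (ModelFrobenioid.toElem (arithDivisorFunctor F K) (unitsFunctor F K) (divNatTrans F K)) hΦ).obj a''),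
        ρ (h ≫ k) = ρ h ≫ ρ k) →
      (∀ ⦃a a' : (PreFrobenioid.biratSubfunctor (ModelFrobenioid.toElem (arithDivisorFunctor F K) (unitsFunctor F K) (divNatTrans F K))).ModelOf⦄ (f : a ⟶ a'), ρ ((PreFrobenioid.untrToRlf (ModelFrobenioid.toElem (arithDivisorFunctor F K) (unitsFunctor F K) (divNatTrans F K)) hΦ).map f) = (PreFrobenioid.untrToRlf (ModelFrobenioid.toElem (arithDivisorFunctor F K) (unitsFunctor F K) (divNatTrans F K)) hΦ).map f) →
      ∀ (A : FinSubextCat F K) (γ γ' : Algebra.GrothendieckGroup ((arithDivisorFunctor F K).obj (op A)))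
        (k : (PreFrobenioid.untrToRlf (ModelFrobenioid.toElem (arithDivisorFunctor F K) (unitsFunctor F K) (divNatTrans F K)) hΦ).obj ⟨A, γ⟩ ⟶ (PreFrobenioid.untrToRlf (ModelFrobenioid.toElem (arithDivisorFunctor F K) (unitsFunctor F K) (divNatTrans F K)) hΦ).obj ⟨A, γ'⟩), degFr k = 1 → baseMap k = 𝟙 A → ρ k = k)
    {D₂ : Type u₂'} [Category.{v₂'} D₂] {Φ₂ : D₂ᵒᵖ ⥤ CommMonCat.{0}}
    {C₂ : Type u₂} [Category.{v₂} C₂] {F₂ : C₂ ⥤ ElemFrobenioid Φ₂} (hΦ₂ : PreFrobenioid.IsPerfFactorialOn Φ₂)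
    (Ψistr : (PreFrobenioidData.ofFunctor (arithDivisorFunctor F K) (ModelFrobenioid.toElem (arithDivisorFunctor F K) (unitsFunctor F K) (divNatTrans F K))).Istr ⥤ (PreFrobenioidData.ofFunctor Φ₂ F₂).Istr)
    (e₁ : (PreFrobenioidData.ofFunctor (arithDivisorFunctor F K) (ModelFrobenioid.toElem (arithDivisorFunctor F K) (unitsFunctor F K) (divNatTrans F K))).Untr ≌ PreFrobenioid.untrModel (ModelFrobenioid.toElem (arithDivisorFunctor F K) (unitsFunctor F K) (divNatTrans F K)))
    (e₂ : (PreFrobenioidData.ofFunctor Φ₂ F₂).Untr ≌ PreFrobenioid.untrModel F₂)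
    (Ψrlf : PreFrobenioid.rlf (ModelFrobenioid.toElem (arithDivisorFunctor F K) (unitsFunctor F K) (divNatTrans F K)) hΦ ⥤ PreFrobenioid.rlf F₂ hΦ₂) [Ψrlf.IsEquivalence]
    (hsq : Square hΦ hΦ₂ Ψistr e₁ e₂ Ψrlf)
    (Ψ' : PreFrobenioid.rlf (ModelFrobenioid.toElem (arithDivisorFunctor F K) (unitsFunctor F K) (divNatTrans F K)) hΦ ⥤ PreFrobenioid.rlf F₂ hΦ₂) (hsq' : Square hΦ hΦ₂ Ψistr e₁ e₂ Ψ') :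
    Nonempty (Ψ' ≅ Ψrlf) :=
  strongUnique_of_rigidAlong_untrToRlf hΦ hΦ₂ Ψistr e₁ e₂ Ψrlf hsq (untrToRlf_rigid_arith_of_linear hΦ hlin) Ψ' hsq'

end FrdI.Cor54Sub

end Literature.AlgebraicGeometry.Frobenioids

end
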